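import Summits.QuantumFields.BalabanUV.Beta.FP.TowerK2bDoorReadoutMoments
import Literature.MathematicalPhysics.QuantumFieldTheory.Balaban1983to89.Beta.DecimatedMomentSummable

/-!
# `BalabanUV.Beta.FP.TowerK2bDoorPairingSummable` — binder row D1 ∕ (C1) OWNER «beta-an2», PART 43 (§1–§2): **THE SUMMABLE CUT OF THE DOOR-PAIRING BOOKKEEPING** —
# PART 41's window cross-correlation identity WITHOUT finite-support letters: for two lattice columns with absolutely summable second moments and a weight of at
# most quadratic growth, `∑' z, ω z·∑' y, f (y − z)·g y = ∑' y, ∑' w, ω (y − w)·(f w·g y)`, everything summable; hence the zeroth moment of the covariant symmetrised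
# pairing on `ℤᵈ` is the pairing of column sums and vanishes with the door-word column sums

WHY.  The road's socket `FP/StepRecursionFeedNestedCompDoorPairing` displays finite windows `W ⊆ Y`, `Z` and support letters `hSW hτW` — a MODEL: the record's read-out column
`Ŝ = wPhi` decays but is nowhere zero (K2L-DTAD §3), and so does the door-word column (an2 A-6 l.68603, J-NOTE-19 §2); the record's letters are an4's `AbsMoment₂` summability letters
(Literature `DecimatedMomentSummable`).  THIS FILE gives the summable twins of PART 41 with the one analytic step done once:
§1 **`summable_weighted_crossCorrelation`** — for `f g` with `AbsMoment₂` and `|ω z| ≤ B·(1 + |z|₁²)` the family `(y, w) ↦ ω (y − w)·(f w·g y)` is summable on `ℤᵈ × ℤᵈ` (`1 + |y − w|₁² ≤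
   2(1 + |y|₁²)(1 + |w|₁²)`; product of two summable non-negative families, `Summable.of_norm_bounded`), with its fibres; **`tsum_weighted_crossCorrelation`** — the identity above
   (`Summable.tsum_prod`, and the shear `(z, y) ↦ (y, y − z)` by `Equiv.tsum_eq` ∕ `Equiv.summable_iff`);
§2 **`tsum_symPairing_eq`** — the covariant symmetrised pairing on `ℤᵈ` summed over the relative position is the pairing of column sums (PART 40 §1 ∕ PART 41 §2 without windows), and
   **`tsum_symPairing_eq_zero`** under the summable (U)-letter `hΘ : ∀ κ μ, ∑' y, τ_{(κ,y)}(λ_{(μ,0)}) = 0` — an4's `hD0` shape on `ℤᵈ`, record-inhabitable letters.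
§3 the same with `ω = c`, `c·c′` (`tsum_crossCorrelation_additive ∕ _mul2`; additive weights with `|c z| ≤ K·|z|₁`): **`tsum_firstMoment_symPairing_eq`** (PART 41 §3 without windows),
**`tsum_firstMoment_symPairing_eq_zero_of_colSums_eq_zero`** (`hΘ ∧ hS0 ⇒ HasSum (c·X) 0` — an4's `hD1` shape), **`tsum_secondMoment_symPairing_eq_zero_of_dipoles_eq_zero`**
(`hΘ ∧ hS0 ∧` dipoles 0 ⇒ `HasSum (c·c′·X) 0`, every component — `hD2`∕`hDF` shape); the `tsum` twins of PART 42 §1–§3 are the successor's.  [folklore] `tsum` algebra BY NAME;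
no `def`, nothing cited, 0 sorry.  Nothing of Bałaban's asserted, valued or discharged; `hD0∕hD1∕hD2∕hDF` NOT discharged at the record's letters (`hΘ hS0 hS1` + summability letters
DISPLAYED); 0∕4 row-D1 binders (hW ∕ hR ∕ D1Tel ∕ D1Rep); NOT (C1), NOT (T-ID), NOT D1, NEVER «G-an2-4 closed», NOT BetaPertH, NOT continuum, NOT Clay.
HONEST DEPENDENCY (page 1, mandatory): continuum YM on T⁴ ⇐ BetaPertH ∧ nine spine estimates (0/9 proved); BetaPertH ⇐ (D1) ∧ (D4) ∧ CAP+tail;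
G-an2-4 gates asym, D1 and NE2/3/4.  HONEST FRAMING (cell contract, verbatim): «discharging `BetaPertH` makes Bałaban's UV stability UNCONDITIONAL —
a real constructive-QFT result; it is NOT the continuum limit and NOT the Clay problem.»  ABSOLUTE RULE (cell charter, verbatim): «No internally-minted
statement may enter as a cited fact. Every hypothesis is either kernel-proved in this package or a verbatim quotation of a PUBLISHED theorem with page
reference. The manuscript(s) under audit are NOT citable for their own disputed steps — they are the thing under adjudication; programme-internal
(2001/route/tribunal) claims are never citable.»  Row D1 ∕ (C1) OWNER, b2b-balaban-beta-an2 gen 75, 2026-08-28.  No existing file touched.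
-/

noncomputable section

open scoped BigOperators

namespace Summit.QuantumFields.BalabanUV.Beta.FP.TowerK2bDoorPairingSummable

open Literature.MathematicalPhysics.QuantumFieldTheory.Balaban1983to89.B12Sec2to5 (l1 l1_nonneg abs_coord_le_l1)
open Literature.MathematicalPhysics.QuantumFieldTheory.Balaban1983to89.Beta.DecimatedMomentSummable (AbsMoment₂ summable_of_absMoment₂)

variable {d : ℕ}

/-! ## §1 The summable cross-correlation identity -/

/-- [folklore] `ℓ¹` triangle inequality for lattice differences: `|y − w|₁ ≤ |y|₁ + |w|₁`. -/
theorem l1_sub_le' (y w : Fin d → ℤ) : l1 (y - w) ≤ l1 y + l1 w := by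
  simp only [l1, ← Finset.sum_add_distrib]
  refine Finset.sum_le_sum fun i _ => ?_
  simp only [Pi.sub_apply, Int.cast_sub]
  exact abs_sub _ _

/-- [folklore] the quadratic weight of a difference against the product of the two single-variable weights: `1 + |y − w|₁² ≤ 2·(1 + |y|₁²)·(1 + |w|₁²)`. -/
theorem one_add_l1_sub_sq_le (y w : Fin d → ℤ) : 1 + l1 (y - w) ^ 2 ≤ 2 * ((1 + l1 y ^ 2) * (1 + l1 w ^ 2)) := by
  have h := l1_sub_le' y w
  have hy := l1_nonneg y
  have hw := l1_nonneg w
  have h0 := l1_nonneg (y - w)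
  nlinarith [sq_nonneg (l1 y - l1 w), mul_nonneg hy hw, sq_nonneg (l1 y * l1 w), h, h0]

/-- [folklore] **`summable_weighted_crossCorrelation`**: for lattice columns `f`, `g` with absolutely summable second moments and a weight `ω` of at most quadratic growth
(`|ω z| ≤ B·(1 + |z|₁²)`), the cross-correlation family `(y, w) ↦ ω (y − w)·(f w·g y)` is summable on `ℤᵈ × ℤᵈ`. -/
theorem summable_weighted_crossCorrelation {f g : (Fin d → ℤ) → ℝ} (hf : AbsMoment₂ f) (hg : AbsMoment₂ g) {ω : (Fin d → ℤ) → ℝ} {B : ℝ}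
    (hω : ∀ z, |ω z| ≤ B * (1 + l1 z ^ 2)) :
    Summable (fun p : (Fin d → ℤ) × (Fin d → ℤ) => ω (p.1 - p.2) * (f p.2 * g p.1)) := by
  have hnn : ∀ h : (Fin d → ℤ) → ℝ, 0 ≤ fun y => (1 + l1 y ^ 2) * |h y| := fun h y => mul_nonneg (by positivity) (abs_nonneg _)
  have hM : Summable (fun p : (Fin d → ℤ) × (Fin d → ℤ) => (2 * B) * (((1 + l1 p.1 ^ 2) * |g p.1|) * ((1 + l1 p.2 ^ 2) * |f p.2|))) :=
    (hg.mul_of_nonneg hf (hnn g) (hnn f)).mul_left (2 * B)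
  refine Summable.of_norm_bounded hM fun p => ?_
  obtain ⟨y, w⟩ := p
  rw [Real.norm_eq_abs, abs_mul, abs_mul]
  have hB : 0 ≤ B := by
    have := hω 0
    have h1 : (0 : ℝ) ≤ |ω 0| := abs_nonneg _
    have h2 : 0 < 1 + l1 (0 : Fin d → ℤ) ^ 2 := by positivity
    nlinarith
  calc |ω (y - w)| * (|f w| * |g y|) ≤ B * (1 + l1 (y - w) ^ 2) * (|f w| * |g y|) :=
        mul_le_mul_of_nonneg_right (hω _) (by positivity)
    _ ≤ B * (2 * ((1 + l1 y ^ 2) * (1 + l1 w ^ 2))) * (|f w| * |g y|) :=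
        mul_le_mul_of_nonneg_right (mul_le_mul_of_nonneg_left (one_add_l1_sub_sq_le y w) hB) (by positivity)
    _ = (2 * B) * (((1 + l1 y ^ 2) * |g y|) * ((1 + l1 w ^ 2) * |f w|)) := by ring

/-- [folklore] the sheared family `(z, y) ↦ ω z·(f (y − z)·g y)` is summable too (it is §1's family through the shear `(z, y) ↦ (y, y − z)`). -/
theorem summable_weighted_crossCorrelation_shear {f g : (Fin d → ℤ) → ℝ} (hf : AbsMoment₂ f) (hg : AbsMoment₂ g) {ω : (Fin d → ℤ) → ℝ} {B : ℝ}
    (hω : ∀ z, |ω z| ≤ B * (1 + l1 z ^ 2)) :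
    Summable (fun q : (Fin d → ℤ) × (Fin d → ℤ) => ω q.1 * (f (q.2 - q.1) * g q.2)) := by
  let e : (Fin d → ℤ) × (Fin d → ℤ) ≃ (Fin d → ℤ) × (Fin d → ℤ) :=
    { toFun := fun q => (q.2, q.2 - q.1), invFun := fun p => (p.1 - p.2, p.1),
      left_inv := fun q => by simp, right_inv := fun p => by simp }
  have h := (e.summable_iff (f := fun p : (Fin d → ℤ) × (Fin d → ℤ) => ω (p.1 - p.2) * (f p.2 * g p.1))).mpr
    (summable_weighted_crossCorrelation hf hg hω)
  refine h.congr fun q => ?_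
  show ω (q.2 - (q.2 - q.1)) * (f (q.2 - q.1) * g q.2) = ω q.1 * (f (q.2 - q.1) * g q.2)
  rw [sub_sub_cancel]

/-- [folklore] **`tsum_weighted_crossCorrelation` — PART 41 §1 WITHOUT WINDOWS**: under §1's letters,
`∑' z, ω z·∑' y, f (y − z)·g y = ∑' y, ∑' w, ω (y − w)·(f w·g y)`. -/
theorem tsum_weighted_crossCorrelation {f g : (Fin d → ℤ) → ℝ} (hf : AbsMoment₂ f) (hg : AbsMoment₂ g) {ω : (Fin d → ℤ) → ℝ} {B : ℝ}
    (hω : ∀ z, |ω z| ≤ B * (1 + l1 z ^ 2)) :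
    ∑' z, ω z * ∑' y, f (y - z) * g y = ∑' y, ∑' w, ω (y - w) * (f w * g y) := by
  have hF := summable_weighted_crossCorrelation hf hg hω
  have hH := summable_weighted_crossCorrelation_shear hf hg hω
  -- left side as a product sum
  have hL : ∑' z, ω z * ∑' y, f (y - z) * g y = ∑' q : (Fin d → ℤ) × (Fin d → ℤ), ω q.1 * (f (q.2 - q.1) * g q.2) := by
    rw [hH.tsum_prod]
    exact tsum_congr fun z => by rw [← tsum_mul_left]
  -- right side as a product sum
  have hR : ∑' y, ∑' w, ω (y - w) * (f w * g y) = ∑' p : (Fin d → ℤ) × (Fin d → ℤ), ω (p.1 - p.2) * (f p.2 * g p.1) := by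
    rw [hF.tsum_prod]
  rw [hL, hR]
  -- the shear
  let e : (Fin d → ℤ) × (Fin d → ℤ) ≃ (Fin d → ℤ) × (Fin d → ℤ) :=
    { toFun := fun q => (q.2, q.2 - q.1), invFun := fun p => (p.1 - p.2, p.1),
      left_inv := fun q => by simp, right_inv := fun p => by simp }
  rw [← e.tsum_eq (fun p : (Fin d → ℤ) × (Fin d → ℤ) => ω (p.1 - p.2) * (f p.2 * g p.1))]
  exact tsum_congr fun q => by
    show ω q.1 * (f (q.2 - q.1) * g q.2) = ω (q.2 - (q.2 - q.1)) * (f (q.2 - q.1) * g q.2)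
    rw [sub_sub_cancel]

/-! ## §2 The zeroth moment of the covariant symmetrised pairing on `ℤᵈ` -/

/-- [folklore] separable weights factorise (unconditional over `ℝ`): `∑' y, ∑' w, (a y·b w)·(f w·g y) = (∑' y, a y·g y)·(∑' w, b w·f w)`. -/
theorem tsum_tsum_sep (a b f g : (Fin d → ℤ) → ℝ) :
    ∑' y, ∑' w, (a y * b w) * (f w * g y) = (∑' y, a y * g y) * (∑' w, b w * f w) := by
  rw [← tsum_mul_right]
  refine tsum_congr fun y => ?_
  rw [← tsum_mul_left]
  exact tsum_congr fun w => by ring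

/-- [folklore] the window-free double sum factorises: `∑' y, ∑' w, f w·g y = (∑' w, f w)·(∑' y, g y)`. -/
theorem tsum_tsum_mul (f g : (Fin d → ℤ) → ℝ) : ∑' y, ∑' w, f w * g y = (∑' w, f w) * (∑' y, g y) := by
  have h := tsum_tsum_sep (fun _ => (1 : ℝ)) (fun _ => (1 : ℝ)) f g
  simp only [one_mul] at h
  rw [h, mul_comm]

/-- [folklore] a weight of at most quadratic growth against a column with absolutely summable second moment is summable. -/
theorem summable_weight_mul {g a : (Fin d → ℤ) → ℝ} (hg : AbsMoment₂ g) {K : ℝ} (ha : ∀ y, |a y| ≤ K * (1 + l1 y ^ 2)) :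
    Summable (fun y => a y * g y) := by
  refine Summable.of_norm_bounded (hg.mul_left K) fun y => ?_
  rw [Real.norm_eq_abs, abs_mul]
  calc |a y| * |g y| ≤ K * (1 + l1 y ^ 2) * |g y| := mul_le_mul_of_nonneg_right (ha y) (abs_nonneg _)
    _ = K * ((1 + l1 y ^ 2) * |g y|) := by ring

/-- [folklore] an additive weight with a linear `ℓ¹` bound has quadratic growth: `|c z| ≤ K·|z|₁ ⇒ |c z| ≤ K·(1 + |z|₁²)`. -/
theorem abs_le_quad_of_le_l1 {c : (Fin d → ℤ) → ℝ} {K : ℝ} (hK : 0 ≤ K) (hc : ∀ z, |c z| ≤ K * l1 z) (z : Fin d → ℤ) :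
    |c z| ≤ K * (1 + l1 z ^ 2) := by
  have h0 := l1_nonneg z
  have h1 : l1 z ≤ 1 + l1 z ^ 2 := by nlinarith [sq_nonneg (l1 z - 1)]
  exact (hc z).trans (mul_le_mul_of_nonneg_left h1 hK)

/-- [folklore] … and so has a product of two such weights: `|c z·c′ z| ≤ K·K′·(1 + |z|₁²)`. -/
theorem abs_mul_le_quad_of_le_l1 {c c' : (Fin d → ℤ) → ℝ} {K K' : ℝ} (hK : 0 ≤ K) (hK' : 0 ≤ K') (hc : ∀ z, |c z| ≤ K * l1 z)
    (hc' : ∀ z, |c' z| ≤ K' * l1 z) (z : Fin d → ℤ) : |c z * c' z| ≤ K * K' * (1 + l1 z ^ 2) := by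
  rw [abs_mul]
  have h0 := l1_nonneg z
  calc |c z| * |c' z| ≤ K * l1 z * (K' * l1 z) := mul_le_mul (hc z) (hc' z) (abs_nonneg _) (by nlinarith [hc z, abs_nonneg (c z)])
    _ = K * K' * l1 z ^ 2 := by ring
    _ ≤ K * K' * (1 + l1 z ^ 2) := by nlinarith [mul_nonneg hK hK']

/-- [folklore] **`tsum_crossCorrelation_eq_mul`** (`ω = 1`): the outer family `z ↦ ∑' y, f (y − z)·g y` is summable and `∑' z, ∑' y, f (y − z)·g y = (∑' w, f w)·(∑' y, g y)`. -/
theorem tsum_crossCorrelation_eq_mul {f g : (Fin d → ℤ) → ℝ} (hf : AbsMoment₂ f) (hg : AbsMoment₂ g) :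
    Summable (fun z : Fin d → ℤ => ∑' y, f (y - z) * g y) ∧ ∑' z, ∑' y, f (y - z) * g y = (∑' w, f w) * (∑' y, g y) := by
  have hω : ∀ z : Fin d → ℤ, |(fun _ : Fin d → ℤ => (1 : ℝ)) z| ≤ 1 * (1 + l1 z ^ 2) := fun z => by simp only [abs_one, one_mul]; nlinarith [sq_nonneg (l1 z)]
  have hs := summable_weighted_crossCorrelation_shear hf hg hω
  have h1 := tsum_weighted_crossCorrelation hf hg hω
  simp only [one_mul] at hs h1
  exact ⟨hs.prod, by rw [h1, tsum_tsum_mul f g]⟩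

/-- [folklore] **`tsum_crossCorrelation_additive`** (`ω = c` ADDITIVE, `|c z| ≤ K·|z|₁`): the outer family `z ↦ c z·∑' y, f (y − z)·g y` is summable and
`∑' z, c z·∑' y, f (y − z)·g y = (∑' w, f w)·(∑' y, c y·g y) − (∑' w, c w·f w)·(∑' y, g y)`  (`c (y − w) = c y − c w`). -/
theorem tsum_crossCorrelation_additive {f g : (Fin d → ℤ) → ℝ} (hf : AbsMoment₂ f) (hg : AbsMoment₂ g) (c : (Fin d → ℤ) →+ ℝ) {K : ℝ} (hK : 0 ≤ K)
    (hc : ∀ z, |c z| ≤ K * l1 z) :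
    Summable (fun z : Fin d → ℤ => c z * ∑' y, f (y - z) * g y) ∧
      ∑' z, c z * ∑' y, f (y - z) * g y = (∑' w, f w) * (∑' y, c y * g y) - (∑' w, c w * f w) * (∑' y, g y) := by
  have hω : ∀ z : Fin d → ℤ, |c z| ≤ K * (1 + l1 z ^ 2) := abs_le_quad_of_le_l1 hK hc
  have hs := summable_weighted_crossCorrelation_shear hf hg hω
  refine ⟨(hs.prod).congr fun z => by
    show ∑' y, c z * (f (y - z) * g y) = c z * ∑' y, f (y - z) * g y
    exact tsum_mul_left, ?_⟩
  rw [tsum_weighted_crossCorrelation hf hg hω]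
  -- expand `c (y − w)` and split; every piece is summable
  have hcf : Summable (fun w => c w * f w) := summable_weight_mul hf hω
  have hcg : Summable (fun y => c y * g y) := summable_weight_mul hg hω
  have hf0 := summable_of_absMoment₂ hf
  have hg0 := summable_of_absMoment₂ hg
  have hin : ∀ y, ∑' w, c (y - w) * (f w * g y) = c y * g y * (∑' w, f w) - g y * (∑' w, c w * f w) := by
    intro y
    have e1 : (fun w => c (y - w) * (f w * g y)) = fun w => (c y * g y) * f w - g y * (c w * f w) :=
      funext fun w => by rw [map_sub]; ring
    rw [e1, ((hf0.mul_left (c y * g y))).tsum_sub (hcf.mul_left (g y)), tsum_mul_left, tsum_mul_left]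
  rw [tsum_congr hin, ((hcg.mul_right (∑' w, f w))).tsum_sub (hg0.mul_right (∑' w, c w * f w)), tsum_mul_right, tsum_mul_right]
  ring

/-- [folklore] **`tsum_crossCorrelation_mul2`** (`ω = c·c′`, two additive weights with linear `ℓ¹` bounds): the outer family is summable and
`∑' z, c z·c′ z·∑' y, f (y − z)·g y = (∑' f)·(∑' c c′·g) − (∑' c·f)·(∑' c′·g) − (∑' c′·f)·(∑' c·g) + (∑' c c′·f)·(∑' g)`. -/
theorem tsum_crossCorrelation_mul2 {f g : (Fin d → ℤ) → ℝ} (hf : AbsMoment₂ f) (hg : AbsMoment₂ g) (c c' : (Fin d → ℤ) →+ ℝ) {K K' : ℝ} (hK : 0 ≤ K) (hK' : 0 ≤ K')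
    (hc : ∀ z, |c z| ≤ K * l1 z) (hc' : ∀ z, |c' z| ≤ K' * l1 z) :
    Summable (fun z : Fin d → ℤ => (c z * c' z) * ∑' y, f (y - z) * g y) ∧
      ∑' z, (c z * c' z) * ∑' y, f (y - z) * g y
        = (∑' w, f w) * (∑' y, (c y * c' y) * g y) - (∑' w, c w * f w) * (∑' y, c' y * g y)
          - (∑' w, c' w * f w) * (∑' y, c y * g y) + (∑' w, (c w * c' w) * f w) * (∑' y, g y) := by
  have hω : ∀ z : Fin d → ℤ, |c z * c' z| ≤ K * K' * (1 + l1 z ^ 2) := abs_mul_le_quad_of_le_l1 hK hK' hc hc'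
  have hs := summable_weighted_crossCorrelation_shear hf hg hω
  refine ⟨(hs.prod).congr fun z => by
    show ∑' y, (c z * c' z) * (f (y - z) * g y) = (c z * c' z) * ∑' y, f (y - z) * g y
    exact tsum_mul_left, ?_⟩
  rw [tsum_weighted_crossCorrelation hf hg hω]
  have hωc : ∀ z : Fin d → ℤ, |c z| ≤ K * (1 + l1 z ^ 2) := abs_le_quad_of_le_l1 hK hc
  have hωc' : ∀ z : Fin d → ℤ, |c' z| ≤ K' * (1 + l1 z ^ 2) := abs_le_quad_of_le_l1 hK' hc'
  have hcf : Summable (fun w => c w * f w) := summable_weight_mul hf hωc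
  have hc'f : Summable (fun w => c' w * f w) := summable_weight_mul hf hωc'
  have hccf : Summable (fun w => (c w * c' w) * f w) := summable_weight_mul hf hω
  have hcg : Summable (fun y => c y * g y) := summable_weight_mul hg hωc
  have hc'g : Summable (fun y => c' y * g y) := summable_weight_mul hg hωc'
  have hccg : Summable (fun y => (c y * c' y) * g y) := summable_weight_mul hg hω
  have hf0 := summable_of_absMoment₂ hf
  have hg0 := summable_of_absMoment₂ hg
  have hin : ∀ y, ∑' w, (c (y - w) * c' (y - w)) * (f w * g y)
      = (c y * c' y) * g y * (∑' w, f w) - c' y * g y * (∑' w, c w * f w) - c y * g y * (∑' w, c' w * f w) + g y * (∑' w, (c w * c' w) * f w) := by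
    intro y
    have e1 : (fun w => (c (y - w) * c' (y - w)) * (f w * g y))
        = fun w => (((c y * c' y) * g y) * f w - c' y * g y * (c w * f w)) - c y * g y * (c' w * f w) + g y * ((c w * c' w) * f w) :=
      funext fun w => by rw [map_sub, map_sub]; ring
    rw [e1, Summable.tsum_add ?_ (hccf.mul_left _), Summable.tsum_sub ?_ (hc'f.mul_left _), (hf0.mul_left _).tsum_sub (hcf.mul_left _),
      tsum_mul_left, tsum_mul_left, tsum_mul_left, tsum_mul_left]
    · exact (hf0.mul_left _).sub (hcf.mul_left _)
    · exact ((hf0.mul_left _).sub (hcf.mul_left _)).sub (hc'f.mul_left _)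
  rw [tsum_congr hin]
  rw [Summable.tsum_add ?_ (hg0.mul_right _), Summable.tsum_sub ?_ (hcg.mul_right _), (hccg.mul_right _).tsum_sub (hc'g.mul_right _),
    tsum_mul_right, tsum_mul_right, tsum_mul_right, tsum_mul_right]
  · ring
  · exact (hccg.mul_right _).sub (hc'g.mul_right _)
  · exact ((hccg.mul_right _).sub (hc'g.mul_right _)).sub (hcg.mul_right _)

section Pairing

variable {D V : Type*} [Fintype D] [AddCommGroup V] [Module ℝ V]

/-- [folklore] **`tsum_symPairing_eq`** — PART 40 §1 ∕ PART 41 §2 ON THE LATTICE WITH SUMMABILITY LETTERS: for read-out columns `S ν z κ y` and door-word columns `y ↦ τ_{(κ,y)}(λ_{(μ,z)})`,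
jointly covariant (`hS`, `hτ`) and with absolutely summable second moments at the base (`hSa`, `hτa`), the pairing summed over the relative position `z ∈ ℤᵈ` is the pairing of column
sums: `∑' z, Σ_κ ∑' y, (S ν z κ y·τ_{(κ,y)}(λ_{(μ,0)}) + S μ 0 κ y·τ_{(κ,y)}(λ_{(ν,z)})) = Σ_κ ((∑' w, S ν 0 κ w)·(∑' y, τ_{(κ,y)}(λ_{(μ,0)})) + (∑' y, S μ 0 κ y)·(∑' w, τ_{(κ,w)}(λ_{(ν,0)})))`. -/
theorem tsum_symPairing_eq (S : D → (Fin d → ℤ) → D → (Fin d → ℤ) → ℝ) (tau : D → (Fin d → ℤ) → V →ₗ[ℝ] ℝ) (lam : D → (Fin d → ℤ) → V)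
    (hS : ∀ (ν : D) (z : Fin d → ℤ) (κ : D) (y : Fin d → ℤ), S ν z κ y = S ν 0 κ (y - z))
    (hτ : ∀ (κ : D) (y : Fin d → ℤ) (μ : D) (z : Fin d → ℤ), tau κ y (lam μ z) = tau κ (y - z) (lam μ 0))
    (hSa : ∀ (ν κ : D), AbsMoment₂ (fun w => S ν 0 κ w)) (hτa : ∀ (κ μ : D), AbsMoment₂ (fun y => tau κ y (lam μ 0))) (μ ν : D) :
    ∑' z, ∑ κ, ∑' y, (S ν z κ y * tau κ y (lam μ 0) + S μ 0 κ y * tau κ y (lam ν z))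
      = ∑ κ, ((∑' w, S ν 0 κ w) * (∑' y, tau κ y (lam μ 0)) + (∑' y, S μ 0 κ y) * (∑' w, tau κ w (lam ν 0))) := by
  have hω : ∀ z : Fin d → ℤ, |(fun _ : Fin d → ℤ => (1 : ℝ)) z| ≤ 1 * (1 + l1 z ^ 2) := fun z => by simp only [abs_one, one_mul]; nlinarith [sq_nonneg (l1 z)]
  -- the two halves per κ, as functions of z, with their fibrewise summability
  have hA : ∀ κ, Summable (fun z : Fin d → ℤ => ∑' y, S ν 0 κ (y - z) * tau κ y (lam μ 0)) ∧
      ∑' z, ∑' y, S ν 0 κ (y - z) * tau κ y (lam μ 0) = (∑' w, S ν 0 κ w) * (∑' y, tau κ y (lam μ 0)) :=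
    fun κ => tsum_crossCorrelation_eq_mul (hSa ν κ) (hτa κ μ)
  have hB : ∀ κ, Summable (fun z : Fin d → ℤ => ∑' y, tau κ (y - z) (lam ν 0) * S μ 0 κ y) ∧
      ∑' z, ∑' y, tau κ (y - z) (lam ν 0) * S μ 0 κ y = (∑' w, tau κ w (lam ν 0)) * (∑' y, S μ 0 κ y) :=
    fun κ => tsum_crossCorrelation_eq_mul (hτa κ ν) (hSa μ κ)
  have hAf : ∀ κ (z : Fin d → ℤ), Summable (fun y => S ν 0 κ (y - z) * tau κ y (lam μ 0)) := fun κ z => by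
    have hs := summable_weighted_crossCorrelation_shear (hSa ν κ) (hτa κ μ) hω
    simp only [one_mul] at hs
    exact hs.prod_factor z
  have hBf : ∀ κ (z : Fin d → ℤ), Summable (fun y => tau κ (y - z) (lam ν 0) * S μ 0 κ y) := fun κ z => by
    have hs := summable_weighted_crossCorrelation_shear (hτa κ ν) (hSa μ κ) hω
    simp only [one_mul] at hs
    exact hs.prod_factor z
  -- rewrite the summand pointwise by covariance, split the inner tsum and the finite sum
  have hpt : ∀ z : Fin d → ℤ, ∑ κ, ∑' y, (S ν z κ y * tau κ y (lam μ 0) + S μ 0 κ y * tau κ y (lam ν z))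
      = ∑ κ, ((∑' y, S ν 0 κ (y - z) * tau κ y (lam μ 0)) + ∑' y, tau κ (y - z) (lam ν 0) * S μ 0 κ y) := by
    intro z
    refine Finset.sum_congr rfl fun κ _ => ?_
    rw [← (hAf κ z).tsum_add (hBf κ z)]
    exact tsum_congr fun y => by rw [hS ν z κ y, hτ κ y ν z, mul_comm (S μ 0 κ y)]
  rw [tsum_congr hpt, Summable.tsum_finsetSum (fun κ _ => (hA κ).1.add (hB κ).1)]
  refine Finset.sum_congr rfl fun κ _ => ?_
  rw [(hA κ).1.tsum_add (hB κ).1, (hA κ).2, (hB κ).2, mul_comm (∑' w, tau κ w (lam ν 0))]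

/-- [folklore] **`tsum_symPairing_eq_zero`** — an4's `hD0` SHAPE ON `ℤᵈ` FROM THE SUMMABLE (U)-LETTER: if every door-word column sums to zero (`hΘ : ∑' y, τ_{(κ,y)}(λ_{(μ,0)}) = 0`),
the pairing summed over the relative position vanishes for every source pair. -/
theorem tsum_symPairing_eq_zero (S : D → (Fin d → ℤ) → D → (Fin d → ℤ) → ℝ) (tau : D → (Fin d → ℤ) → V →ₗ[ℝ] ℝ) (lam : D → (Fin d → ℤ) → V)
    (hS : ∀ (ν : D) (z : Fin d → ℤ) (κ : D) (y : Fin d → ℤ), S ν z κ y = S ν 0 κ (y - z))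
    (hτ : ∀ (κ : D) (y : Fin d → ℤ) (μ : D) (z : Fin d → ℤ), tau κ y (lam μ z) = tau κ (y - z) (lam μ 0))
    (hSa : ∀ (ν κ : D), AbsMoment₂ (fun w => S ν 0 κ w)) (hτa : ∀ (κ μ : D), AbsMoment₂ (fun y => tau κ y (lam μ 0)))
    (hΘ : ∀ (κ μ : D), ∑' y, tau κ y (lam μ 0) = 0) (μ ν : D) :
    ∑' z, ∑ κ, ∑' y, (S ν z κ y * tau κ y (lam μ 0) + S μ 0 κ y * tau κ y (lam ν z)) = 0 := by
  rw [tsum_symPairing_eq S tau lam hS hτ hSa hτa μ ν]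
  simp only [hΘ, mul_zero, add_zero, Finset.sum_const_zero]

/-! ## §3 First and second moments of the pairing on `ℤᵈ` (PART 41 §3–§4 ∕ PART 42 §4 in summability letters) -/

/-- [folklore] **`tsum_firstMoment_symPairing_eq`** (`ω = c` additive, `|c z| ≤ K·|z|₁`): the outer family is summable and
`∑' z, c z·X((μ,0),(ν,z)) = Σ_κ ((∑' S_ν)(∑' c·τ^μ) − (∑' c·S_ν)(∑' τ^μ) + (∑' c·S_μ)(∑' τ^ν) − (∑' S_μ)(∑' c·τ^ν))(κ)` — PART 41 §3 without windows. -/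
theorem tsum_firstMoment_symPairing_eq (S : D → (Fin d → ℤ) → D → (Fin d → ℤ) → ℝ) (tau : D → (Fin d → ℤ) → V →ₗ[ℝ] ℝ) (lam : D → (Fin d → ℤ) → V)
    (hS : ∀ (ν : D) (z : Fin d → ℤ) (κ : D) (y : Fin d → ℤ), S ν z κ y = S ν 0 κ (y - z))
    (hτ : ∀ (κ : D) (y : Fin d → ℤ) (μ : D) (z : Fin d → ℤ), tau κ y (lam μ z) = tau κ (y - z) (lam μ 0))
    (hSa : ∀ (ν κ : D), AbsMoment₂ (fun w => S ν 0 κ w)) (hτa : ∀ (κ μ : D), AbsMoment₂ (fun y => tau κ y (lam μ 0)))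
    (c : (Fin d → ℤ) →+ ℝ) {K : ℝ} (hK : 0 ≤ K) (hc : ∀ z, |c z| ≤ K * l1 z) (μ ν : D) :
    Summable (fun z : Fin d → ℤ => c z * ∑ κ, ∑' y, (S ν z κ y * tau κ y (lam μ 0) + S μ 0 κ y * tau κ y (lam ν z))) ∧
    ∑' z, c z * ∑ κ, ∑' y, (S ν z κ y * tau κ y (lam μ 0) + S μ 0 κ y * tau κ y (lam ν z))
      = ∑ κ, ((∑' w, S ν 0 κ w) * (∑' y, c y * tau κ y (lam μ 0)) - (∑' w, c w * S ν 0 κ w) * (∑' y, tau κ y (lam μ 0))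
          + (∑' y, c y * S μ 0 κ y) * (∑' w, tau κ w (lam ν 0)) - (∑' y, S μ 0 κ y) * (∑' w, c w * tau κ w (lam ν 0))) := by
  have hω : ∀ z : Fin d → ℤ, |c z| ≤ K * (1 + l1 z ^ 2) := abs_le_quad_of_le_l1 hK hc
  have hA : ∀ κ, Summable (fun z : Fin d → ℤ => c z * ∑' y, S ν 0 κ (y - z) * tau κ y (lam μ 0)) ∧
      ∑' z, c z * ∑' y, S ν 0 κ (y - z) * tau κ y (lam μ 0)
        = (∑' w, S ν 0 κ w) * (∑' y, c y * tau κ y (lam μ 0)) - (∑' w, c w * S ν 0 κ w) * (∑' y, tau κ y (lam μ 0)) :=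
    fun κ => tsum_crossCorrelation_additive (hSa ν κ) (hτa κ μ) c hK hc
  have hB : ∀ κ, Summable (fun z : Fin d → ℤ => c z * ∑' y, tau κ (y - z) (lam ν 0) * S μ 0 κ y) ∧
      ∑' z, c z * ∑' y, tau κ (y - z) (lam ν 0) * S μ 0 κ y
        = (∑' w, tau κ w (lam ν 0)) * (∑' y, c y * S μ 0 κ y) - (∑' w, c w * tau κ w (lam ν 0)) * (∑' y, S μ 0 κ y) :=
    fun κ => tsum_crossCorrelation_additive (hτa κ ν) (hSa μ κ) c hK hc
  have hω1 : ∀ z : Fin d → ℤ, |(fun _ : Fin d → ℤ => (1 : ℝ)) z| ≤ 1 * (1 + l1 z ^ 2) := fun z => by simp only [abs_one, one_mul]; nlinarith [sq_nonneg (l1 z)]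
  have hAf : ∀ κ (z : Fin d → ℤ), Summable (fun y => S ν 0 κ (y - z) * tau κ y (lam μ 0)) := fun κ z => by
    have hs := summable_weighted_crossCorrelation_shear (hSa ν κ) (hτa κ μ) hω1
    simp only [one_mul] at hs
    exact hs.prod_factor z
  have hBf : ∀ κ (z : Fin d → ℤ), Summable (fun y => tau κ (y - z) (lam ν 0) * S μ 0 κ y) := fun κ z => by
    have hs := summable_weighted_crossCorrelation_shear (hτa κ ν) (hSa μ κ) hω1
    simp only [one_mul] at hs
    exact hs.prod_factor z
  have hpt : ∀ z : Fin d → ℤ, c z * ∑ κ, ∑' y, (S ν z κ y * tau κ y (lam μ 0) + S μ 0 κ y * tau κ y (lam ν z))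
      = ∑ κ, (c z * ∑' y, S ν 0 κ (y - z) * tau κ y (lam μ 0) + c z * ∑' y, tau κ (y - z) (lam ν 0) * S μ 0 κ y) := by
    intro z
    rw [Finset.mul_sum]
    refine Finset.sum_congr rfl fun κ _ => ?_
    rw [← mul_add, ← (hAf κ z).tsum_add (hBf κ z)]
    congr 1
    exact tsum_congr fun y => by rw [hS ν z κ y, hτ κ y ν z, mul_comm (S μ 0 κ y)]
  refine ⟨(summable_sum fun κ _ => (hA κ).1.add (hB κ).1).congr fun z => (hpt z).symm, ?_⟩
  rw [tsum_congr hpt, Summable.tsum_finsetSum (fun κ _ => (hA κ).1.add (hB κ).1)]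
  refine Finset.sum_congr rfl fun κ _ => ?_
  rw [(hA κ).1.tsum_add (hB κ).1, (hA κ).2, (hB κ).2]
  ring

/-- [folklore] **`tsum_firstMoment_symPairing_eq_zero_of_colSums_eq_zero`** — an4's `hD1` SHAPE on `ℤᵈ`: under the summable (U)-letter `hΘ` AND the read-out column-sum letter
`hS0 : ∑' w, S ν 0 κ w = 0`, the first moment vanishes for EVERY source pair. -/
theorem tsum_firstMoment_symPairing_eq_zero_of_colSums_eq_zero (S : D → (Fin d → ℤ) → D → (Fin d → ℤ) → ℝ) (tau : D → (Fin d → ℤ) → V →ₗ[ℝ] ℝ)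
    (lam : D → (Fin d → ℤ) → V)
    (hS : ∀ (ν : D) (z : Fin d → ℤ) (κ : D) (y : Fin d → ℤ), S ν z κ y = S ν 0 κ (y - z))
    (hτ : ∀ (κ : D) (y : Fin d → ℤ) (μ : D) (z : Fin d → ℤ), tau κ y (lam μ z) = tau κ (y - z) (lam μ 0))
    (hSa : ∀ (ν κ : D), AbsMoment₂ (fun w => S ν 0 κ w)) (hτa : ∀ (κ μ : D), AbsMoment₂ (fun y => tau κ y (lam μ 0)))
    (hΘ : ∀ (κ μ : D), ∑' y, tau κ y (lam μ 0) = 0) (hS0 : ∀ (ν κ : D), ∑' w, S ν 0 κ w = 0)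
    (c : (Fin d → ℤ) →+ ℝ) {K : ℝ} (hK : 0 ≤ K) (hc : ∀ z, |c z| ≤ K * l1 z) (μ ν : D) :
    HasSum (fun z : Fin d → ℤ => c z * ∑ κ, ∑' y, (S ν z κ y * tau κ y (lam μ 0) + S μ 0 κ y * tau κ y (lam ν z))) 0 := by
  obtain ⟨hs, he⟩ := tsum_firstMoment_symPairing_eq S tau lam hS hτ hSa hτa c hK hc μ ν
  have h0 : ∑' z, c z * ∑ κ, ∑' y, (S ν z κ y * tau κ y (lam μ 0) + S μ 0 κ y * tau κ y (lam ν z)) = 0 := by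
    rw [he]
    exact Finset.sum_eq_zero fun κ _ => by rw [hS0 ν κ, hS0 μ κ, hΘ κ μ, hΘ κ ν]; ring
  rw [← h0]
  exact hs.hasSum

/-- [folklore] **`tsum_secondMoment_symPairing_eq_zero_of_dipoles_eq_zero`** — an4's `hD2`∕`hDF` SHAPE on `ℤᵈ`: under `hΘ`, `hS0` and VANISHING READ-OUT DIPOLES for the two additive
weights (`hS1`, `hS1′` — PART 42 §3's package, to be fed by co-closedness + reflections in the same summability letters), the second moment against `c·c′` vanishes for EVERY source
pair — the (1.22) read-out line included; the family is summable. -/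
theorem tsum_secondMoment_symPairing_eq_zero_of_dipoles_eq_zero (S : D → (Fin d → ℤ) → D → (Fin d → ℤ) → ℝ) (tau : D → (Fin d → ℤ) → V →ₗ[ℝ] ℝ)
    (lam : D → (Fin d → ℤ) → V)
    (hS : ∀ (ν : D) (z : Fin d → ℤ) (κ : D) (y : Fin d → ℤ), S ν z κ y = S ν 0 κ (y - z))
    (hτ : ∀ (κ : D) (y : Fin d → ℤ) (μ : D) (z : Fin d → ℤ), tau κ y (lam μ z) = tau κ (y - z) (lam μ 0))
    (hSa : ∀ (ν κ : D), AbsMoment₂ (fun w => S ν 0 κ w)) (hτa : ∀ (κ μ : D), AbsMoment₂ (fun y => tau κ y (lam μ 0)))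
    (hΘ : ∀ (κ μ : D), ∑' y, tau κ y (lam μ 0) = 0) (hS0 : ∀ (ν κ : D), ∑' w, S ν 0 κ w = 0)
    (c c' : (Fin d → ℤ) →+ ℝ) {K K' : ℝ} (hK : 0 ≤ K) (hK' : 0 ≤ K') (hc : ∀ z, |c z| ≤ K * l1 z) (hc' : ∀ z, |c' z| ≤ K' * l1 z)
    (hS1 : ∀ (ν κ : D), ∑' w, c w * S ν 0 κ w = 0) (hS1' : ∀ (ν κ : D), ∑' w, c' w * S ν 0 κ w = 0) (μ ν : D) :
    HasSum (fun z : Fin d → ℤ => (c z * c' z) * ∑ κ, ∑' y, (S ν z κ y * tau κ y (lam μ 0) + S μ 0 κ y * tau κ y (lam ν z))) 0 := by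
  have hA : ∀ κ, Summable (fun z : Fin d → ℤ => (c z * c' z) * ∑' y, S ν 0 κ (y - z) * tau κ y (lam μ 0)) ∧
      ∑' z, (c z * c' z) * ∑' y, S ν 0 κ (y - z) * tau κ y (lam μ 0)
        = (∑' w, S ν 0 κ w) * (∑' y, (c y * c' y) * tau κ y (lam μ 0)) - (∑' w, c w * S ν 0 κ w) * (∑' y, c' y * tau κ y (lam μ 0))
          - (∑' w, c' w * S ν 0 κ w) * (∑' y, c y * tau κ y (lam μ 0)) + (∑' w, (c w * c' w) * S ν 0 κ w) * (∑' y, tau κ y (lam μ 0)) :=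
    fun κ => tsum_crossCorrelation_mul2 (hSa ν κ) (hτa κ μ) c c' hK hK' hc hc'
  have hB : ∀ κ, Summable (fun z : Fin d → ℤ => (c z * c' z) * ∑' y, tau κ (y - z) (lam ν 0) * S μ 0 κ y) ∧
      ∑' z, (c z * c' z) * ∑' y, tau κ (y - z) (lam ν 0) * S μ 0 κ y
        = (∑' w, tau κ w (lam ν 0)) * (∑' y, (c y * c' y) * S μ 0 κ y) - (∑' w, c w * tau κ w (lam ν 0)) * (∑' y, c' y * S μ 0 κ y)
          - (∑' w, c' w * tau κ w (lam ν 0)) * (∑' y, c y * S μ 0 κ y) + (∑' w, (c w * c' w) * tau κ w (lam ν 0)) * (∑' y, S μ 0 κ y) :=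
    fun κ => tsum_crossCorrelation_mul2 (hτa κ ν) (hSa μ κ) c c' hK hK' hc hc'
  have hω1 : ∀ z : Fin d → ℤ, |(fun _ : Fin d → ℤ => (1 : ℝ)) z| ≤ 1 * (1 + l1 z ^ 2) := fun z => by simp only [abs_one, one_mul]; nlinarith [sq_nonneg (l1 z)]
  have hAf : ∀ κ (z : Fin d → ℤ), Summable (fun y => S ν 0 κ (y - z) * tau κ y (lam μ 0)) := fun κ z => by
    have hs := summable_weighted_crossCorrelation_shear (hSa ν κ) (hτa κ μ) hω1
    simp only [one_mul] at hs
    exact hs.prod_factor z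
  have hBf : ∀ κ (z : Fin d → ℤ), Summable (fun y => tau κ (y - z) (lam ν 0) * S μ 0 κ y) := fun κ z => by
    have hs := summable_weighted_crossCorrelation_shear (hτa κ ν) (hSa μ κ) hω1
    simp only [one_mul] at hs
    exact hs.prod_factor z
  have hpt : ∀ z : Fin d → ℤ, (c z * c' z) * ∑ κ, ∑' y, (S ν z κ y * tau κ y (lam μ 0) + S μ 0 κ y * tau κ y (lam ν z))
      = ∑ κ, ((c z * c' z) * ∑' y, S ν 0 κ (y - z) * tau κ y (lam μ 0) + (c z * c' z) * ∑' y, tau κ (y - z) (lam ν 0) * S μ 0 κ y) := by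
    intro z
    rw [Finset.mul_sum]
    refine Finset.sum_congr rfl fun κ _ => ?_
    rw [← mul_add, ← (hAf κ z).tsum_add (hBf κ z)]
    congr 1
    exact tsum_congr fun y => by rw [hS ν z κ y, hτ κ y ν z, mul_comm (S μ 0 κ y)]
  have hs : Summable (fun z : Fin d → ℤ => (c z * c' z) * ∑ κ, ∑' y, (S ν z κ y * tau κ y (lam μ 0) + S μ 0 κ y * tau κ y (lam ν z))) :=
    (summable_sum fun κ _ => (hA κ).1.add (hB κ).1).congr fun z => (hpt z).symm
  have h0 : ∑' z, (c z * c' z) * ∑ κ, ∑' y, (S ν z κ y * tau κ y (lam μ 0) + S μ 0 κ y * tau κ y (lam ν z)) = 0 := by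
    rw [tsum_congr hpt, Summable.tsum_finsetSum (fun κ _ => (hA κ).1.add (hB κ).1)]
    refine Finset.sum_eq_zero fun κ _ => ?_
    rw [(hA κ).1.tsum_add (hB κ).1, (hA κ).2, (hB κ).2, hS0 ν κ, hS0 μ κ, hΘ κ μ, hΘ κ ν, hS1 ν κ, hS1' ν κ, hS1 μ κ, hS1' μ κ]
    ring
  rw [← h0]
  exact hs.hasSum

end Pairing

end Summit.QuantumFields.BalabanUV.Beta.FP.TowerK2bDoorPairingSummable

end
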